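import Mathlib
import Literature.Analysis.Calculus.ClosedSubgroupExpChart
import HarnessLib

/-!
# Pair-rigidity kills the infinitesimal joint commutant (`h⁰ = 0` at a point)
# (route-independent helper toward the crux `TwistExponentGap.RigidTwistCeiling` ⟨stmt-QuantumFields-24054⟩; free hands of
# width seat ym-line-sfw-p2-w3)

The crux's rigidity hypothesis is GROUP-theoretic: every pair `(a, b)` in `G` with commutator `z` has a FINITE centraliser.  The
Morse–Bott chain (✓p774936, ✓p775025, ✓p775240, ✓p775343) and the lattice `h⁰ = 0 ⇒ h¹ = 0` theorem (✓p775387 Koszul,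
`TwistExponentGapLatticeCocycle`) consume it in INFINITESIMAL form: no non-zero `X` in the Lie algebra `𝔤_ρ = {X | exp(ℝX) ⊆ ρ(G)}`
of the compact matrix group `ρ(G)` is fixed by `Ad ρ(a)` and `Ad ρ(b)` (equivalently commutes with `ρ a` and `ρ b`).  This file
proves that passage (`eq_zero_of_commute_of_finite_centralizer`): `exp(tX)` commutes with `ρ a`, `ρ b`, so its `ρ`-preimage lies
in the finite centraliser; `t ↦ exp(tX)` is a continuous map of the connected line into a finite set, hence constant `= 1`, and
`X = d/dt exp(tX)|₀ = 0`.  Faithfulness of `ρ` is used to pull the commutation back to `G`.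
What it feeds: at a `z`-twisted-flat lattice configuration `U₀` a covariantly constant `𝔤_ρ`-valued section is fixed at `x₀` by
`Ad` of the two holonomies of `U₀` along the cycles of the twisted plane through `x₀`, whose commutator is `z^{±1}` (one twisted
plaquette per slice; lattice Stokes on the `S × S` slice — NOT proved here); with this file that section vanishes, i.e. `h⁰ = 0`,
and `lattice_cocycle_exact` gives `h¹ = 0`.
HONEST FRAMING: elementary; nothing here bears on a summit statement or on the Yang–Mills mass gap.
-/

set_option autoImplicit false

noncomputable section

open scoped Matrix.Norms.Frobenius
open NormedSpace

namespace Summit.QuantumFields.YangMills.Theorems.TwistExponentGap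

/-- A one-parameter group `t ↦ exp(tX)` in `M_N(ℂ)` taking values in a finite set is trivial, and then `X = 0`. -/
theorem eq_zero_of_exp_smul_mem_finite {N : ℕ} {X : Matrix (Fin N) (Fin N) ℂ} {F : Set (Matrix (Fin N) (Fin N) ℂ)}
    (hF : F.Finite) (hX : ∀ t : ℝ, exp (t • X) ∈ F) : X = 0 := by
  haveI : Finite F := hF.to_subtype
  let f : ℝ → F := fun t => ⟨exp (t • X), hX t⟩
  have hf : Continuous f :=
    (exp_continuous.comp (continuous_id.smul continuous_const)).subtype_mk _
  have hconst : ∀ t : ℝ, f t = f 0 := fun t => PreconnectedSpace.constant inferInstance hf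
  have hexp1 : ∀ t : ℝ, exp (t • X) = 1 := fun t => by
    have h := congrArg Subtype.val (hconst t)
    simpa [f, zero_smul, exp_zero] using h
  have h1 : HasDerivAt (fun u : ℝ => exp (u • X)) (exp ((0 : ℝ) • X) * X) 0 := hasDerivAt_exp_smul_const X 0
  have h2 : HasDerivAt (fun u : ℝ => exp (u • X)) 0 0 := by
    have hfun : (fun u : ℝ => exp (u • X)) = fun _ => 1 := funext hexp1
    rw [hfun]
    exact hasDerivAt_const 0 1
  have h := h1.unique h2
  simpa [zero_smul, exp_zero] using h

/-- **Pair-rigidity ⇒ no infinitesimal joint commutant.** For a faithful matrix representation `ρ` of `G` and `a, b ∈ G` with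
FINITE centraliser `{k | ka = ak ∧ kb = bk}`, every `X` with `exp(ℝX) ⊆ ρ(G)` (an element of the Lie algebra of the matrix group
`ρ(G)`) commuting with `ρ a` and `ρ b` vanishes. -/
theorem eq_zero_of_commute_of_finite_centralizer {G : Type*} [Group G] {N : ℕ} (ρ : G →* Matrix (Fin N) (Fin N) ℂ)
    (hinj : Function.Injective ρ) {a b : G} (hfin : Set.Finite {k : G | k * a = a * k ∧ k * b = b * k})
    {X : Matrix (Fin N) (Fin N) ℂ} (hX : ∀ t : ℝ, exp (t • X) ∈ Set.range ρ)
    (ha : Commute (ρ a) X) (hb : Commute (ρ b) X) : X = 0 := by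
  refine eq_zero_of_exp_smul_mem_finite (hfin.image ρ) fun t => ?_
  obtain ⟨k, hk⟩ := hX t
  have hca : Commute (ρ a) (exp (t • X)) := (ha.smul_right t).exp_right
  have hcb : Commute (ρ b) (exp (t • X)) := (hb.smul_right t).exp_right
  refine ⟨k, ⟨?_, ?_⟩, hk⟩
  · apply hinj
    rw [map_mul, map_mul, hk]
    exact hca.eq.symm
  · apply hinj
    rw [map_mul, map_mul, hk]
    exact hcb.eq.symm

end Summit.QuantumFields.YangMills.Theorems.TwistExponentGap

end
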